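import Summits.QuantumFields.YangMills.Theorems.CovariantDischargeCombWalkLetters
import Summits.QuantumFields.YangMills.Theorems.CovariantDischargeFramedSweepInvariance
import Summits.QuantumFields.YangMills.Theorems.CovariantDischargeFramedPlaquetteTransport
import HarnessLib

/-!
# Line «sandwich_discharge» on crux `HistoryTailL` (stmt-QuantumFields-19936), stub `stub_sandwichSweepGapCapped` — (R0) CONCRETE:
# THE COMB-FRAMED ONE-AXIS SWEEP ON A TORUS BALL IS A `dU`-PRESERVING BIJECTION (hypotheses = geometry only)

Cell `ym3-torus` (YM ladder rung R3 = continuum SU(2) Yang–Mills on the three-torus — a RUNG, NOT the Clay problem: not d = 4, not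
infinite volume, not a mass gap), width seat `ym-ust-19936-w5` gen 14, helper letters `--supports stmt-QuantumFields-19936`.

The B6 door (px8 g7 ARCH-S′ v2) sweeps the fine field by `U_b ↦ expPoint(c_b • Ad_{G_b(U)} n̂₀)·U_b` with COMB FRAMES
`G_b(U) = (axialT U c b.src)⁻¹` (lit `B10Eq27TorusAxialLog.axialT U c y = U(Γ_{c→y})`, the staircase transport from the centre `c`), on a
set `S` of bonds whose sources lie in a ball `{c + z : ‖z‖_∞ ≤ r}` that does not wrap (`2r <` period).  B2″
(✓`CovariantDischargeFramedSweepInvariance`) reduced the four-clause sweep package of the stub to STEP-INVARIANCE plus per-step Haar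
invariance, and its §3 reduced step-invariance to three tree alternatives for the transport; ✓`CovariantDischargeCombWalkLetters` proved the
alternatives for staircase words.  THIS FILE assembles:

* §1 `axialT` through the window: `axialT U c (c + z) = holT U c (treeWord z)` (`rel c (c+z) = z`), measurability of `U ↦ axialT U c y`,
  prefix-closedness of the comb (`treeWord (disp prefix) = prefix`).
* §2 ★★`axialT_update_alternatives` — for `‖z‖_∞ ≤ r`, `2r <` period and ANY bond `b′`: the transport `U ↦ axialT U c (c+z)` satisfies one of
  B2″ §3's three alternatives with respect to `U_{b′}`, UNIFORMLY in `U` (prefix `= axialT · c b′.src` by prefix-closedness).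
* §3 ★★★`exists_sweep_pair_comb` — for `n̂₀`, amplitudes `cb : PBond → ℝ`, a finite `S` of bonds with sources in the ball: the directions
  `n_b(U) := (axialT U c b.src)⁻¹·expPoint(cb b • n̂₀)·(axialT U c b.src)` (`= expPoint(cb b • Ad_{(axialT U c b.src)⁻¹} n̂₀)`,
  ✓`expPoint_smul_adSU2`) give `Ψ, Ψ′` with `MeasurePreserving Ψ ∧ Measurable Ψ′ ∧ LeftInverse Ψ′ Ψ ∧ RightInverse Ψ′ Ψ` and
  `Ψ′ U b = if b ∈ S then n_b(U)⁻¹·U_b else U_b` — HYPOTHESES = GEOMETRY ONLY.  Own-link-backward bonds are RIGHT translations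
  (✓`measurePreserving_step_of_eq_mul_right`), all others LEFT translations by a `U_b`-independent element.

WHAT THIS IS NOT.  No action estimate, no profile, no choice of `S`, `cb`, `r`; nothing of `stub_sandwichSweepGapCapped`, `HistoryTailL`, the
rung R3, d = 4, a continuum limit or a mass gap is proved.  YM₃ on T³ is rung R3, NOT Clay.
References: T. Bałaban, CMP **98** (1985) 17–51 [Balaban1985Averaging] ((8)–(10) p.19; p.24 the combs `Γ_{y,x}`); CMP **122** (1989) 175–202
[Balaban1989LargeFieldI] ((1.77) p.194).  Elementary ([folklore]).
-/

noncomputable section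

open MeasureTheory

namespace Summit.QuantumFields.YangMills.Theorems.CovariantDischargeCombFrameSweep

open Literature.MathematicalPhysics.QuantumFieldTheory.Balaban1983to89
open Literature.MathematicalPhysics.QuantumFieldTheory.Balaban1983to89.B10Eq27TorusAxialLog
  (transl transl_apply transl_zero transl_add transl_add_e transl_sub_e holT holT_nil holT_cons_true holT_cons_false holT_append
    holT_eq_holAt rel rel_transl_of_mem axialT)
open Literature.MathematicalPhysics.QuantumFieldTheory.Balaban1983to89.B7Prop1Explicit
  (Letter e e_apply seg seg_natCast seg_negSucc seg_zero mem_seg treeWord disp disp_append disp_replicate disp_flatMap disp_seg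
    flatMap_congr_of)
open Summit.QuantumFields.YangMills.Theorems.CovariantDischargeCombWalkLetters

variable {P : Params} {j : ℕ}

/-! ## §1 The comb through the no-wrap window -/

section Window

variable {G : Type*} [Group G]

/-- The window condition of lit `rel_transl_of_mem` from an `ℓ^∞` bound: `‖z‖_∞ ≤ r`, `2r <` period. [folklore] -/
theorem window_of_le {r : ℕ} (hr : 2 * r < P.sitesPerDir j) {z : Fin P.d → ℤ} (hz : ∀ ν, (z ν).natAbs ≤ r) :
    ∀ ν, z ν * 2 ∈ Set.Ioc (-(P.sitesPerDir j : ℤ)) (P.sitesPerDir j) := by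
  intro ν
  have h := hz ν
  constructor <;> omega

/-- **THE COMB THROUGH THE WINDOW**: `axialT U c (c + z) = holT U c (treeWord z)` for `‖z‖_∞ ≤ r`, `2r <` period. [cite: Balaban1985Averaging, p.24] -/
theorem axialT_transl_eq {r : ℕ} (hr : 2 * r < P.sitesPerDir j) {z : Fin P.d → ℤ} (hz : ∀ ν, (z ν).natAbs ≤ r)
    (U : GaugeField P j G) (c : Site P j) : axialT U c (transl c z) = holT U c (treeWord z) := by
  unfold axialT
  rw [rel_transl_of_mem c z (window_of_le hr hz)]

/-- The tree word unfolded as the staircase over the directions `[d−1, …, 0]`. [cite: Balaban1985Averaging, p.24] -/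
theorem treeWord_eq_flatMap (v : Fin P.d → ℤ) :
    treeWord v = (List.finRange P.d).reverse.flatMap fun κ => seg κ (v κ) := rfl

/-- Coordinates of the displacement of a staircase over distinct directions: `z ν` on the listed directions, `0` elsewhere. [folklore] -/
theorem disp_flatMap_seg_apply (z : Fin P.d → ℤ) :
    ∀ (ks : List (Fin P.d)), ks.Nodup → ∀ ν, disp (ks.flatMap fun κ => seg κ (z κ)) ν = if ν ∈ ks then z ν else 0
  | [], _, ν => by simp
  | κ :: ks, hnd, ν => by
    have hκ : κ ∉ ks := (List.nodup_cons.mp hnd).1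
    rw [List.flatMap_cons, disp_append, disp_seg, Pi.add_apply, disp_flatMap_seg_apply z ks (List.nodup_cons.mp hnd).2 ν,
      Pi.smul_apply, smul_eq_mul, e_apply]
    by_cases hν : ν = κ
    · subst hν; simp [hκ]
    · simp [hν, List.mem_cons]


/-- Nodup bookkeeping for a split direction list `ks = ks₁ ++ κ :: ks₂`. [folklore] -/
theorem nodup_split {ks ks₁ ks₂ : List (Fin P.d)} {κ : Fin P.d} (hnd : ks.Nodup) (hks : ks = ks₁ ++ κ :: ks₂) :
    ks₁.Nodup ∧ κ ∉ ks₁ ∧ (∀ ν ∈ ks₂, ν ∉ ks₁ ∧ ν ≠ κ) := by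
  subst hks
  have h1 : ks₁.Nodup := hnd.of_append_left
  have h2 := List.nodup_append.mp hnd
  refine ⟨h1, fun hκ => ?_, fun ν hν => ⟨fun hν₁ => ?_, fun hνκ => ?_⟩⟩
  · exact h2.2.2 κ hκ κ List.mem_cons_self rfl
  · exact h2.2.2 ν hν₁ ν (List.mem_cons_of_mem κ hν) rfl
  · subst hνκ; exact (List.nodup_cons.mp h2.2.1).1 hν

/-- The displacement of a comb prefix `ks₁`-legs `+ s·e_κ` (`κ ∉ ks₁`) stays in the window when `|s| ≤ r` and `‖z‖_∞ ≤ r`. [folklore] -/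
theorem natAbs_prefix_disp_le {r : ℕ} {z : Fin P.d → ℤ} (hz : ∀ ν, (z ν).natAbs ≤ r) {ks₁ : List (Fin P.d)} {κ : Fin P.d}
    (hnd : ks₁.Nodup) (hκ : κ ∉ ks₁) {s : ℤ} (hs : s.natAbs ≤ r) (ν : Fin P.d) :
    ((disp (ks₁.flatMap fun κ' => seg κ' (z κ')) + s • e κ) ν).natAbs ≤ r := by
  rw [Pi.add_apply, disp_flatMap_seg_apply z ks₁ hnd ν, Pi.smul_apply, smul_eq_mul, e_apply]
  by_cases hν : ν = κ
  · subst hν; simp only [hκ, if_false, if_true, zero_add, mul_one]; exact hs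
  · simp only [hν, if_false, mul_zero, add_zero]
    split_ifs
    · exact hz ν
    · simp

/-- **PREFIX-CLOSEDNESS OF THE COMB**: the tree word of the displacement of a comb prefix (`ks₁`-legs of `z`, then `s` steps along the
next direction `κ`) IS that prefix. [cite: Balaban1985Averaging, p.24] -/
theorem treeWord_prefix_disp {z : Fin P.d → ℤ} {ks₁ ks₂ : List (Fin P.d)} {κ : Fin P.d}
    (hks : (List.finRange P.d).reverse = ks₁ ++ κ :: ks₂) (s : ℤ) :
    treeWord (disp (ks₁.flatMap fun κ' => seg κ' (z κ')) + s • e κ) = (ks₁.flatMap fun κ' => seg κ' (z κ')) ++ seg κ s := by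
  have hnd : ((List.finRange P.d).reverse).Nodup := List.nodup_reverse.mpr (List.nodup_finRange P.d)
  obtain ⟨hnd₁, hκ, hks₂⟩ := nodup_split hnd hks
  set u : Fin P.d → ℤ := disp (ks₁.flatMap fun κ' => seg κ' (z κ')) + s • e κ with hu
  have hu_apply : ∀ ν, u ν = (if ν ∈ ks₁ then z ν else 0) + s * (if ν = κ then 1 else 0) := fun ν => by
    rw [hu, Pi.add_apply, disp_flatMap_seg_apply z ks₁ hnd₁ ν, Pi.smul_apply, smul_eq_mul, e_apply]
  have h₁ : ∀ ν ∈ ks₁, seg ν (u ν) = seg ν (z ν) := fun ν hν => by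
    have hνκ : ν ≠ κ := fun h => hκ (h ▸ hν)
    rw [hu_apply, if_pos hν, if_neg hνκ, mul_zero, add_zero]
  have hκu : u κ = s := by rw [hu_apply, if_neg hκ, if_pos rfl, mul_one, zero_add]
  have h₂ : ∀ ν ∈ ks₂, seg ν (u ν) = [] := fun ν hν => by
    rw [hu_apply, if_neg (hks₂ ν hν).1, if_neg (hks₂ ν hν).2, mul_zero, add_zero, seg_zero]
  rw [treeWord_eq_flatMap, hks, List.flatMap_append, List.flatMap_cons, flatMap_congr_of h₁, hκu,
    List.flatMap_eq_nil_iff.mpr h₂, List.append_nil]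

end Window

section Meas

variable {G : Type*} [GaugeGroup G] [MeasurableSpace G] [MeasurableMul₂ G] [MeasurableInv G]

/-- Measurability of the comb transport `U ↦ axialT U c y` (a finite product of coordinates and inverses). [folklore] -/
theorem measurable_holT (x : Site P j) (w : List (Letter P.d)) : Measurable fun U : GaugeField P j G => holT U x w := by
  have : (fun U : GaugeField P j G => holT U x w) = fun U => T4Continuum.holAt U (T4Continuum.walk x w) := by
    funext U; exact holT_eq_holAt U x w
  rw [this]
  exact T4Continuum.measurable_holAt _

end Meas

/-! ## §2 The three tree alternatives for the comb transport -/

section Alternatives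

variable {G : Type*} [Group G] [DecidableEq (PBond P j)]

/-- ★★ **THE COMB TRANSPORT AGAINST ONE BOND — B2″ §3's ALTERNATIVES, UNIFORMLY IN THE FIELD.**  For a centre `c`, a window `‖z‖_∞ ≤ r`,
`2r <` period, and ANY bond `b′`: the transport `U ↦ axialT U c (c + z)` either (i) does not read `U_{b′}`; or (ii) traverses `b′` once,
forward, after the comb prefix to `b′.src` — `axialT U c (c+z) = axialT U c b′.src · U_{b′} · B U` for ALL `U`, with `axialT · c b′.src` and
`B` not reading `U_{b′}`; or (iii) once, backward — `axialT U c b′.src = A U · U_{b′}⁻¹` and `axialT U c (c+z) = A U · U_{b′}⁻¹ · B U`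
for all `U`, `A`, `B` not reading `U_{b′}`. [cite: Balaban1985Averaging, (9) p.18, p.24] -/
theorem axialT_update_alternatives (c : Site P j) {r : ℕ} (hr : 2 * r < P.sitesPerDir j) {z : Fin P.d → ℤ}
    (hz : ∀ ν, (z ν).natAbs ≤ r) (b' : PBond P j) :
    (∀ (U : GaugeField P j G) (g : G), axialT (Function.update U b' g) c (transl c z) = axialT U c (transl c z)) ∨
    (∃ B : GaugeField P j G → G, (∀ (U : GaugeField P j G) (g : G), B (Function.update U b' g) = B U) ∧
        (∀ (U : GaugeField P j G) (g : G), axialT (Function.update U b' g) c b'.src = axialT U c b'.src) ∧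
        ∀ U : GaugeField P j G, axialT U c (transl c z) = axialT U c b'.src * U b' * B U) ∨
    (∃ A B : GaugeField P j G → G, (∀ (U : GaugeField P j G) (g : G), A (Function.update U b' g) = A U) ∧
        (∀ (U : GaugeField P j G) (g : G), B (Function.update U b' g) = B U) ∧
        (∀ U : GaugeField P j G, axialT U c b'.src = A U * (U b')⁻¹) ∧
        ∀ U : GaugeField P j G, axialT U c (transl c z) = A U * (U b')⁻¹ * B U) := by
  have hnd : ((List.finRange P.d).reverse).Nodup := List.nodup_reverse.mpr (List.nodup_finRange P.d)
  have hv : ∀ κ ∈ (List.finRange P.d).reverse, (z κ).natAbs < P.sitesPerDir j := fun κ _ => by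
    have := hz κ; omega
  have hax : ∀ U : GaugeField P j G, axialT U c (transl c z) = holT U c ((List.finRange P.d).reverse.flatMap fun κ => seg κ (z κ)) :=
    fun U => by rw [axialT_transl_eq hr hz, treeWord_eq_flatMap]
  rcases holT_comb_update_alternatives (G := G) b' z (List.finRange P.d).reverse c hnd hv with
    h1 | ⟨ks₁, ks₂, t, hks, ht, hbeq, hpre, hsuf, hfac⟩ | ⟨ks₁, ks₂, t, hks, ht, hbeq, hpre, hsuf, hfac⟩
  · exact Or.inl fun U g => by rw [hax, hax, h1]
  · -- forward: the prefix IS the comb to `b′.src`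
    right; left
    obtain ⟨hnd₁, hκ, -⟩ := nodup_split hnd hks
    have hzκ := hz b'.dir
    have ht' : ((t : ℤ)).natAbs ≤ r := by omega
    have hwin := natAbs_prefix_disp_le hz hnd₁ hκ ht'
    have hsrc : b'.src = transl c (disp (ks₁.flatMap fun κ' => seg κ' (z κ')) + (t : ℤ) • e b'.dir) := by
      conv_lhs => rw [hbeq]
      rw [transl_add]
    have hpref : ∀ U : GaugeField P j G,
        axialT U c b'.src = holT U c ((ks₁.flatMap fun κ' => seg κ' (z κ')) ++ List.replicate t (b'.dir, true)) := fun U => by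
      rw [hsrc, axialT_transl_eq hr hwin, treeWord_prefix_disp hks, seg_natCast]
    refine ⟨fun U => holT U b'.tgt (List.replicate ((z b'.dir).toNat - (t + 1)) (b'.dir, true) ++
        ks₂.flatMap fun κ => seg κ (z κ)), hsuf, fun U g => by rw [hpref, hpref, hpre], fun U => ?_⟩
    rw [hax, hfac, hpref, mul_assoc]
  · -- backward: the comb to `b′.src` is the prefix followed by the backward step through `b′`
    right; right
    obtain ⟨hnd₁, hκ, -⟩ := nodup_split hnd hks
    have hzκ := hz b'.dir
    have ht' : (-((t : ℤ) + 1)).natAbs ≤ r := by omega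
    have hwin := natAbs_prefix_disp_le hz hnd₁ hκ ht'
    have hsrc : b'.src = transl c (disp (ks₁.flatMap fun κ' => seg κ' (z κ')) + (-((t : ℤ) + 1)) • e b'.dir) := by
      conv_lhs => rw [hbeq]
      rw [transl_add]
    have htgt : transl c (disp ((ks₁.flatMap fun κ' => seg κ' (z κ')) ++ List.replicate t (b'.dir, false))) = b'.tgt := by
      rw [PBond.tgt, hsrc, ← transl_add_e, disp_append, disp_replicate, Letter.vec_false]
      congr 1
      module
    have hpref : ∀ U : GaugeField P j G,
        axialT U c b'.src = holT U c ((ks₁.flatMap fun κ' => seg κ' (z κ')) ++ List.replicate t (b'.dir, false)) * (U b')⁻¹ :=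
      fun U => by
      rw [hsrc, axialT_transl_eq hr hwin, treeWord_prefix_disp hks,
        show (-((t : ℤ) + 1)) = Int.negSucc t from (Int.negSucc_eq t).symm, seg_negSucc, List.replicate_succ',
        ← List.append_assoc, holT_append, htgt, holT_cons_false, holT_nil, mul_one, PBond.tgt, Site.unshift_shift]
    refine ⟨fun U => holT U c ((ks₁.flatMap fun κ' => seg κ' (z κ')) ++ List.replicate t (b'.dir, false)),
      fun U => holT U b'.src (List.replicate ((-z b'.dir).toNat - (t + 1)) (b'.dir, false) ++ ks₂.flatMap fun κ => seg κ (z κ)),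
      hpre, hsuf, hpref, fun U => ?_⟩
    rw [hax, hfac, mul_assoc]

end Alternatives

/-! ## §3 `SU(2)`: the comb-framed sweep pair, hypotheses = geometry only -/

section Package

open Literature.MathematicalPhysics.QuantumFieldTheory.Balaban1983to89.T4CubeChartGnomonic (SU2)
open Literature.MathematicalPhysics.QuantumFieldTheory.Balaban1983to89.T4HaarSU2ExpChart (expPoint measurable_expPoint)
open Literature.MathematicalPhysics.QuantumFieldTheory.Balaban1983to89.B15Prop1ChartSU2 (adSU2)
open Summit.QuantumFields.YangMills.Theorems.CovariantDischargeFramedSweepInvariance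
  (exists_sweep_pair_of_stepInvariant_of_haar measurePreserving_step_of_eq_mul_right framedDir_update_eq framedDir_update_inv_eq
    framedStep_mul_eq_mul_conj)
open Summit.QuantumFields.YangMills.Theorems.CovariantDischargeFramedPlaquetteTransport (expPoint_smul_adSU2)
open Summit.QuantumFields.YangMills.Theorems.CovariantDischargeHaarSweepReweighting (measurePreserving_update_mul_left)

/-- The comb-framed direction in product form: `expPoint(c • Ad_{(axialT U c y)⁻¹} n̂₀) = (axialT U c y)⁻¹·expPoint(c•n̂₀)·axialT U c y`.
[cite: Balaban1989LargeFieldI, (1.77) p.194] -/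
theorem expPoint_smul_adSU2_axialT_inv (U : GaugeField P j SU2) (c y : Site P j) (a : ℝ) (n : EuclideanSpace ℝ (Fin 3)) :
    expPoint (a • adSU2 (axialT U c y)⁻¹ n) = (axialT U c y)⁻¹ * expPoint (a • n) * axialT U c y := by
  rw [expPoint_smul_adSU2, inv_inv]

/-- Measurability of the comb-framed direction field `U ↦ expPoint(c • Ad_{(axialT U c y)⁻¹} n̂₀)`. [folklore] -/
theorem measurable_framedDir (c y : Site P j) (a : ℝ) (n : EuclideanSpace ℝ (Fin 3)) :
    Measurable fun U : GaugeField P j SU2 => expPoint (a • adSU2 (axialT U c y)⁻¹ n) := by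
  have e : (fun U : GaugeField P j SU2 => expPoint (a • adSU2 (axialT U c y)⁻¹ n)) =
      fun U => (axialT U c y)⁻¹ * expPoint (a • n) * axialT U c y := by
    funext U; exact expPoint_smul_adSU2_axialT_inv U c y a n
  rw [e]
  have hm : Measurable fun U : GaugeField P j SU2 => axialT U c y := by
    unfold axialT; exact measurable_holT c _
  exact (hm.inv.mul measurable_const).mul hm

variable [DecidableEq (PBond P j)]

/-- B2″ §3's per-field hypothesis `halt` from the field-uniform alternatives of §2. [folklore] -/
theorem halt_of_alternatives {G : Type*} [Group G] (Pt : Site P j → GaugeField P j G → G) (y : Site P j) (b' : PBond P j)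
    (h : (∀ (U : GaugeField P j G) (g : G), Pt y (Function.update U b' g) = Pt y U) ∨
      (∃ B : GaugeField P j G → G, (∀ (U : GaugeField P j G) (g : G), B (Function.update U b' g) = B U) ∧
        (∀ (U : GaugeField P j G) (g : G), Pt b'.src (Function.update U b' g) = Pt b'.src U) ∧
        ∀ U : GaugeField P j G, Pt y U = Pt b'.src U * U b' * B U) ∨
      (∃ A B : GaugeField P j G → G, (∀ (U : GaugeField P j G) (g : G), A (Function.update U b' g) = A U) ∧
        (∀ (U : GaugeField P j G) (g : G), B (Function.update U b' g) = B U) ∧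
        (∀ U : GaugeField P j G, Pt b'.src U = A U * (U b')⁻¹) ∧ ∀ U : GaugeField P j G, Pt y U = A U * (U b')⁻¹ * B U))
    (U : GaugeField P j G) :
    (∀ g : G, Pt y (Function.update U b' g) = Pt y U) ∨
      (∃ B : GaugeField P j G → G, (∀ g : G, B (Function.update U b' g) = B U) ∧
        (∀ g : G, Pt b'.src (Function.update U b' g) = Pt b'.src U) ∧
        ∀ V : GaugeField P j G, (∀ b, b ≠ b' → V b = U b) → Pt y V = Pt b'.src V * V b' * B V) ∨
      (∃ A B : GaugeField P j G → G, (∀ g : G, A (Function.update U b' g) = A U) ∧ (∀ g : G, B (Function.update U b' g) = B U) ∧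
        Pt b'.src U = A U * (U b')⁻¹ ∧
        ∀ V : GaugeField P j G, (∀ b, b ≠ b' → V b = U b) → Pt y V = A V * (V b')⁻¹ * B V) := by
  rcases h with h | ⟨B, hB, hA, hf⟩ | ⟨A, B, hA, hB, hs, hf⟩
  · exact Or.inl (h U)
  · exact Or.inr (Or.inl ⟨B, hB U, hA U, fun V _ => hf V⟩)
  · exact Or.inr (Or.inr ⟨A, B, hA U, hB U, hs U, fun V _ => hf V⟩)

/-- ★★★ **THE COMB-FRAMED ONE-AXIS SWEEP IS A `dU`-PRESERVING BIJECTION — HYPOTHESES = GEOMETRY ONLY.**  For a centre `c`, a radius `r` with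
`2r <` period, a finite set `S` of bonds whose sources lie in the ball `{c + z : ‖z‖_∞ ≤ r}`, a unit-or-not axis `n̂₀` and amplitudes `cb`,
the comb-framed directions `n_b(U) = expPoint(cb b • Ad_{(axialT U c b.src)⁻¹} n̂₀)` sweep as a measure-preserving bijection `Ψ` with the
SIMULTANEOUS inverse `Ψ′ U = (b ↦ n_b(U)⁻¹·U_b on S)` — B2″ ✓`exists_sweep_pair_of_stepInvariant_of_haar` with `hstep`∕`hstepInv` from
§2 + ✓`framedDir_update_eq`, and per-step Haar invariance by a LEFT translation (alternatives (i)(ii) at `y = b.src`) or a RIGHT one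
((iii): ✓`framedStep_mul_eq_mul_conj` + ✓`measurePreserving_step_of_eq_mul_right`). [cite: Balaban1985Averaging, (10) p.19, p.24] -/
theorem exists_sweep_pair_comb (c : Site P j) {r : ℕ} (hr : 2 * r < P.sitesPerDir j) (S : Finset (PBond P j))
    (hS : ∀ b ∈ S, ∃ z : Fin P.d → ℤ, (∀ ν, (z ν).natAbs ≤ r) ∧ b.src = transl c z)
    (n : EuclideanSpace ℝ (Fin 3)) (cb : PBond P j → ℝ) (nf : PBond P j → GaugeField P j SU2 → SU2)
    (hnf : ∀ b U, nf b U = expPoint (cb b • adSU2 (axialT U c b.src)⁻¹ n)) :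
    ∃ Ψ Ψ' : GaugeField P j SU2 → GaugeField P j SU2,
      MeasurePreserving Ψ (fieldMeasure P j SU2) (fieldMeasure P j SU2) ∧ Measurable Ψ' ∧
        Function.LeftInverse Ψ' Ψ ∧ Function.RightInverse Ψ' Ψ ∧
        (∀ U b, Ψ U b = if b ∈ S then nf b U * U b else U b) ∧
        (∀ U b, Ψ' U b = if b ∈ S then (nf b U)⁻¹ * U b else U b) := by
  have hnf' : ∀ b, nf b = fun U => expPoint (cb b • adSU2 (axialT U c b.src)⁻¹ n) := fun b => funext (hnf b)
  -- measurability
  have hn : ∀ b, Measurable (nf b) := fun b => by rw [hnf']; exact measurable_framedDir c b.src (cb b) n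
  -- step-invariance, forward and inverse
  have hstep : ∀ (b b' : PBond P j) (U : GaugeField P j SU2), b ∈ S → b' ∈ S →
      nf b (Function.update U b' (nf b' U * U b')) = nf b U := by
    intro b b' U hb _
    obtain ⟨z, hz, hsrc⟩ := hS b hb
    have halt := halt_of_alternatives (fun y V => axialT V c y) (transl c z) b'
      (axialT_update_alternatives (G := SU2) c hr hz b') U
    rw [hnf b, hnf b, hnf b', hsrc]
    exact framedDir_update_eq (fun y V => axialT V c y) n b' (transl c z) U (cb b') (cb b) halt
  have hstepInv : ∀ (b b' : PBond P j) (U : GaugeField P j SU2), b ∈ S → b' ∈ S →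
      nf b (Function.update U b' ((nf b' U)⁻¹ * U b')) = nf b U := by
    intro b b' U hb _
    obtain ⟨z, hz, hsrc⟩ := hS b hb
    have halt := halt_of_alternatives (fun y V => axialT V c y) (transl c z) b'
      (axialT_update_alternatives (G := SU2) c hr hz b') U
    rw [hnf b, hnf b, hnf b', hsrc]
    exact framedDir_update_inv_eq (fun y V => axialT V c y) n b' (transl c z) U (cb b') (cb b) halt
  -- per-step Haar invariance: left translation unless the comb to `b.src` ends through `b` backwards (then right translation)
  have hhaar : ∀ b ∈ S, MeasurePreserving (fun U : GaugeField P j SU2 => Function.update U b (nf b U * U b))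
      (fieldMeasure P j SU2) (fieldMeasure P j SU2) := by
    intro b hb
    obtain ⟨z, hz, hsrc⟩ := hS b hb
    rcases axialT_update_alternatives (G := SU2) c hr hz b with h1 | ⟨B, -, hA, -⟩ | ⟨A, B, hA, -, hs, -⟩
    · refine measurePreserving_update_mul_left b (hn b) fun U g => ?_
      rw [hnf, hnf, hsrc, h1]
    · refine measurePreserving_update_mul_left b (hn b) fun U g => ?_
      rw [hnf, hnf, hA]
    · have hAm : Measurable A := by
        have e : A = fun U => axialT U c b.src * U b := funext fun U => by rw [hs U, inv_mul_cancel_right]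
        rw [e]
        have hm : Measurable fun U : GaugeField P j SU2 => axialT U c b.src := by
          unfold axialT; exact measurable_holT c _
        exact hm.mul (measurable_pi_apply b)
      refine measurePreserving_step_of_eq_mul_right nf b (K := fun U => (A U)⁻¹ * expPoint (cb b • n) * A U)
        ((hAm.inv.mul measurable_const).mul hAm) (fun U g => by simp only [hA]) fun U => ?_
      rw [hnf, hs U]
      exact framedStep_mul_eq_mul_conj (A U) (U b) (cb b) n
  exact exists_sweep_pair_of_stepInvariant_of_haar nf S hn hhaar hstep hstepInv

end Package

end Summit.QuantumFields.YangMills.Theorems.CovariantDischargeCombFrameSweep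

end
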